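import Summits.RiemannHypothesis.RiemannHypothesis.Theorems.PfPersistenceMarkovCoreClass
import HarnessLib

/-!
# PF persistence (theory 1, edge law): THE MARKOV CORE OF A NON-NEGATIVE WEIGHT TABLE, VIII —
# every minimising sequence converges to the core ground state modulo phases; real minimising
# sequences are asymptotically one-signed

Helper file (`--supports stmt-RiemannHypothesis-19953`); mechanism/rigidity campaign; no RH claims.
For EVERY weight table `w` with `w n ≥ 0` on the prime index of the window and EVERY `a > 0`
(objects in `PfPersistenceMarkovCore`, package `CorePerronFrobenius` in `…Class`):

* `IsCoreGround.tendsto_of_minimizing` — if `u` is a core ground state and `gₙ` are normalised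
  window test functions with `𝓔^w_a(gₙ) → coreBottom w a`, then for suitable unimodular constants
  `cₙ`, `cₙ gₙ → u` in `L²` (the FULL sequence, not a subsequence: compactness
  `ConnesConsaniMoscovici2025_thm_3_6_holds` along subsequences + lower semicontinuity
  `table_finiteEnergy_of_tendsto` + uniqueness `IsCoreGround.unique` + `tendsto_phase_fix`).
* `exists_pos_even_tendsto_of_minimizing` — the same with the strictly positive even ground
  representative `Φ` of `IsCoreGround.exists_pos_even_rep` as the limit.
* `tendsto_sign_mul_of_minimizing_real` — for REAL-valued minimising window tests the phases can be
  taken in `{1, −1}`: `sₙ gₙ → Φ` in `L²` with `sₙ = ±1`; consequently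
  (`tendsto_negPart_of_minimizing_real`) the negative parts `min (sₙ gₙ, 0)` tend to `0` in `L²` —
  the honest finite-approximation form of channel (I): normalised real approximants whose energies
  approach the core bottom (e.g. Ritz vectors of any Galerkin family whose Ritz values converge to
  the bottom) are ASYMPTOTICALLY ONE-SIGNED.  Nothing is claimed about Ritz values of a particular
  basis.

## References

* E. Bombieri, Rend. Mat. Acc. Lincei (9) 11 (2000) 183–233, §4 Thm 3 (minimising sequences).
* A. Connes, C. Consani, H. Moscovici (2025), Thm 3.6 (compactness on a window).
* M. Reed, B. Simon, *Methods of Modern Mathematical Physics IV* (1978), §XIII.12.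
-/

set_option linter.dupNamespace false

noncomputable section

open MeasureTheory Set Filter
open scoped Topology ENNReal NNReal ComplexConjugate ArithmeticFunction.vonMangoldt

namespace Summit.RiemannHypothesis.RiemannHypothesis.Theorems.PfPersistence

open Literature.NumberTheory.LFunctions Literature.NumberTheory.LFunctions.ConnesVanSuijlekom
open Summit.RiemannHypothesis.RiemannHypothesis.Theorems.WeilWindowFlowWindowLipschitz
open Summit.RiemannHypothesis.RiemannHypothesis.Theorems.WeilGroundStateMarkovPart

/-! ## Minimising sequences converge modulo phases -/

/-- **Every normalised minimising sequence of window test functions converges in `L²`, modulo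
unimodular constants, to the core ground state.** [cite: Bombieri2000Weil, §4 Thm 3] -/
theorem IsCoreGround.tendsto_of_minimizing {a : ℝ} {w : ℕ → ℝ}
    (hw : ∀ n ∈ weilPrimeIndex a, 0 ≤ w n) (ha : 0 < a) {u : ℝ → ℂ} (hu : IsCoreGround w a u)
    {g : ℕ → ℝ → ℂ}
    (hg : ∀ n, IsWeilTest (g n) ∧ tsupport (g n) ⊆ Icc (-a) a ∧ ∫ t, ‖g n t‖ ^ 2 = (1 : ℝ))
    (hE : Tendsto (fun n ↦ tableDirichletEnergy a w (g n)) atTop (𝓝 (coreBottom w a))) :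
    ∃ c : ℕ → ℂ, (∀ n, ‖c n‖ = 1) ∧
      Tendsto (fun n ↦ ∫ x, ‖c n * g n x - u x‖ ^ 2) atTop (𝓝 0) := by
  classical
  have huL : MemLp u 2 := hu.1.1
  have hun : ∫ x, ‖u x‖ ^ 2 = 1 := hu.2.1
  have hgm : ∀ n, MemLp (g n) 2 := fun n ↦ (hg n).1.memLp_two
  -- the phases
  set c : ℕ → ℂ := fun n ↦ if (∫ y, g n y * conj (u y)) = 0 then (1 : ℂ)
    else conj (∫ y, g n y * conj (u y)) / (((‖∫ y, g n y * conj (u y)‖ : ℝ)) : ℂ) with hcdef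
  have hcn : ∀ n, ‖c n‖ = 1 := fun n ↦ by
    simp only [hcdef]
    split_ifs with h
    · exact norm_one
    · rw [norm_div, Complex.norm_conj, Complex.norm_real, Real.norm_of_nonneg (norm_nonneg _),
        div_self (norm_ne_zero_iff.2 h)]
  refine ⟨c, hcn, ?_⟩
  -- subsequence principle
  refine tendsto_of_subseq_tendsto fun ns hns ↦ ?_
  have hEs := hE.comp hns
  -- `Re Q_ζ` is bounded along the subsequence
  have hbdd : BddAbove (Set.range fun k ↦ (weilQuadratic (g (ns k))).re) := by
    obtain ⟨B', hB'⟩ := hEs.bddAbove_range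
    refine ⟨4 * a * Real.exp (2 * a) + 4 * (∑ n ∈ weilPrimeIndex a, (Λ n : ℝ) / Real.sqrt n) +
      B' - weilMarkovConstant a, ?_⟩
    rintro _ ⟨k, rfl⟩
    simp only
    obtain ⟨hgk, hsk, hnk⟩ := hg (ns k)
    rw [weilQuadratic_re_eq_weilPoleForm_add_weilDirichletEnergy_sub hgk hsk, hnk, mul_one]
    have h1 : tableDirichletEnergy a w (g (ns k)) ≤ B' := hB' ⟨k, rfl⟩
    have h2 := weilPoleForm_le_of_sphere ha hgk hsk hnk
    have h3 := weilDirichletEnergy_le_of_table hw hgk.memLp_two (a := a)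
    rw [hnk, mul_one] at h3
    linarith
  -- compactness along the subsequence
  obtain ⟨u', hu', φ, hφ, hlim⟩ := ConnesConsaniMoscovici2025_thm_3_6_holds a ha
    (fun k ↦ g (ns k)) (fun k ↦ hg (ns k)) hbdd
  have hgm' : ∀ k, MemLp (g (ns (φ k))) 2 := fun k ↦ hgm _
  -- the limit is a normalised finite-energy minimiser
  have hu'n : ∫ x, ‖u' x‖ ^ 2 = 1 := by
    have h1 := tendsto_integral_norm_sq hu' hgm' hlim
    simp only [(hg _).2.2] at h1
    exact (tendsto_nhds_unique tendsto_const_nhds h1).symm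
  have hu's : ∀ᵐ x : ℝ, x ∉ Icc (-a) a → u' x = 0 :=
    ae_eq_zero_of_tendsto hu' hgm' (fun k x hx ↦
      image_eq_zero_of_notMem_tsupport fun h' ↦ hx ((hg (ns (φ k))).2.1 h')) hlim
  obtain ⟨hu'f, hu'E⟩ := table_finiteEnergy_of_tendsto (a := a) (w := w)
    (fun k ↦ (hg (ns (φ k))).1) hu' hlim (hEs.comp hφ.tendsto_atTop)
  -- a pointwise-supported representative is a core ground state
  set v₀ : ℝ → ℂ := (Icc (-a) a).indicator (hu'.1.mk u') with hv₀def
  have hv₀u : v₀ =ᵐ[volume] u' := by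
    filter_upwards [hu'.1.ae_eq_mk, hu's] with y h1 h2
    by_cases hy : y ∈ Icc (-a) a
    · rw [hv₀def, indicator_of_mem hy]; exact h1.symm
    · rw [hv₀def, indicator_of_notMem hy, h2 hy]
  have hv₀ : coreAdm a v₀ := by
    refine ⟨hu'.ae_eq hv₀u.symm, fun y hy ↦ indicator_of_notMem hy _, ?_⟩
    rw [weilIncrement_congr_ae hv₀u]
    exact hu'f
  have hv₀n : ∫ y, ‖v₀ y‖ ^ 2 = 1 := by
    rw [← hu'n]; exact integral_congr_ae (hv₀u.mono fun y hy ↦ by simp [hy])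
  have hv₀g : IsCoreGround w a v₀ := by
    refine ⟨hv₀, hv₀n, le_antisymm ?_ (coreBottom_le hw hv₀ hv₀n)⟩
    rw [tableDirichletEnergy_congr_ae a w hv₀u]
    exact hu'E
  -- uniqueness up to a phase: `u' = γ u` a.e.
  obtain ⟨γ, hγ, hγu⟩ := hv₀g.unique hw ha hu
  have hu'γ : u' =ᵐ[volume] fun x ↦ γ * u x := hv₀u.symm.trans hγu
  have hlim' : Tendsto (fun k ↦ ∫ x, ‖g (ns (φ k)) x - γ * u x‖ ^ 2) atTop (𝓝 0) := by
    refine hlim.congr fun k ↦ integral_congr_ae ?_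
    filter_upwards [hu'γ] with x h1
    simp only [h1]
  exact ⟨φ, tendsto_phase_fix huL hun hgm' hγ hlim'⟩

/-- **Minimising sequences localise on the positive even ground representative**: there is an even
`Φ`, `Φ > 0` on `(-a, a)`, `Φ = 0` off `[-a, a]`, itself a core ground state, such that every
normalised minimising sequence of window tests converges to `Φ` in `L²` modulo unimodular
constants. [cite: Bombieri2000Weil, §4 Thm 3] -/
theorem exists_pos_even_tendsto_of_minimizing {a : ℝ} {w : ℕ → ℝ}
    (hw : ∀ n ∈ weilPrimeIndex a, 0 ≤ w n) (ha : 0 < a) :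
    ∃ Φ : ℝ → ℝ, (∀ x, Φ (-x) = Φ x) ∧ (∀ x ∈ Ioo (-a) a, 0 < Φ x) ∧
      (∀ x, x ∉ Icc (-a) a → Φ x = 0) ∧ IsCoreGround w a (fun x ↦ (Φ x : ℂ)) ∧
      ∀ g : ℕ → ℝ → ℂ,
        (∀ n, IsWeilTest (g n) ∧ tsupport (g n) ⊆ Icc (-a) a ∧ ∫ t, ‖g n t‖ ^ 2 = (1 : ℝ)) →
        Tendsto (fun n ↦ tableDirichletEnergy a w (g n)) atTop (𝓝 (coreBottom w a)) →
        ∃ c : ℕ → ℂ, (∀ n, ‖c n‖ = 1) ∧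
          Tendsto (fun n ↦ ∫ x, ‖c n * g n x - (Φ x : ℂ)‖ ^ 2) atTop (𝓝 0) := by
  obtain ⟨u, hu⟩ := exists_isCoreGround hw ha
  obtain ⟨Φ, γ, -, hΦe, hΦp, hΦs, hΦg, -⟩ := hu.exists_pos_even_rep hw ha
  exact ⟨Φ, hΦe, hΦp, hΦs, hΦg, fun g hg hE ↦ hΦg.tendsto_of_minimizing hw ha hg hE⟩

/-! ## Real minimising sequences: signs instead of phases, asymptotic one-signedness -/

/-- For real `g`, `Φ` and a unimodular `c`, replacing `c` by the sign of `∫ g Φ` does not increase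
the `L²` distance to `Φ`: `∫ |s g − Φ|² ≤ ∫ |c g − Φ|²` with `s = ±1`. [folklore] -/
theorem exists_sign_integral_le {g Φ : ℝ → ℝ} (hg : MemLp g 2) (hΦ : MemLp Φ 2) {c : ℂ}
    (hc : ‖c‖ = 1) :
    ∃ s : ℝ, (s = 1 ∨ s = -1) ∧
      ∫ x, ‖((s * g x : ℝ) : ℂ) - (Φ x : ℂ)‖ ^ 2 ≤ ∫ x, ‖c * (g x : ℂ) - (Φ x : ℂ)‖ ^ 2 := by
  -- integrability of the pieces
  have hg2 : Integrable (fun x ↦ g x ^ 2) := by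
    have := (memLp_two_iff_integrable_sq_norm hg.1).1 hg
    simpa only [Real.norm_eq_abs, sq_abs] using this
  have hΦ2 : Integrable (fun x ↦ Φ x ^ 2) := by
    have := (memLp_two_iff_integrable_sq_norm hΦ.1).1 hΦ
    simpa only [Real.norm_eq_abs, sq_abs] using this
  have hgΦ : Integrable (fun x ↦ g x * Φ x) := MemLp.integrable_mul hg hΦ
  set I : ℝ := ∫ x, g x * Φ x with hI
  -- choose the sign of `I`
  set s : ℝ := if 0 ≤ I then 1 else -1 with hs
  have hs1 : s = 1 ∨ s = -1 := by
    by_cases h : 0 ≤ I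
    · exact Or.inl (by simp [hs, h])
    · exact Or.inr (by simp [hs, h])
  have hss : s * s = 1 := by rcases hs1 with h | h <;> simp [h]
  have hsI : s * I = |I| := by
    by_cases h : 0 ≤ I
    · simp [hs, h, abs_of_nonneg h]
    · simp [hs, h, abs_of_neg (lt_of_not_ge h)]
  refine ⟨s, hs1, ?_⟩
  -- expand both sides
  have eL : (fun x ↦ ‖((s * g x : ℝ) : ℂ) - (Φ x : ℂ)‖ ^ 2) =
      fun x ↦ g x ^ 2 - 2 * s * (g x * Φ x) + Φ x ^ 2 := by
    funext x
    rw [← Complex.ofReal_sub, Complex.norm_real, Real.norm_eq_abs, sq_abs]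
    have : (s * g x - Φ x) ^ 2 = s * s * g x ^ 2 - 2 * s * (g x * Φ x) + Φ x ^ 2 := by ring
    rw [this, hss, one_mul]
  have eR : (fun x ↦ ‖c * (g x : ℂ) - (Φ x : ℂ)‖ ^ 2) =
      fun x ↦ g x ^ 2 - 2 * c.re * (g x * Φ x) + Φ x ^ 2 := by
    funext x
    rw [Complex.sq_norm, Complex.normSq_apply]
    simp only [Complex.sub_re, Complex.mul_re, Complex.ofReal_re, Complex.ofReal_im, mul_zero,
      sub_zero, Complex.sub_im, Complex.mul_im, zero_add]
    have hc2 : c.re * c.re + c.im * c.im = 1 := by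
      have h := Complex.sq_norm c
      rw [hc, one_pow, Complex.normSq_apply] at h
      linarith
    nlinarith [hc2]
  have hsplit : ∀ r : ℝ, ∫ x, (g x ^ 2 - 2 * r * (g x * Φ x) + Φ x ^ 2) =
      (∫ x, g x ^ 2) - 2 * r * I + ∫ x, Φ x ^ 2 := by
    intro r
    have e1 : ∫ x, (g x ^ 2 - 2 * r * (g x * Φ x) + Φ x ^ 2) =
        (∫ x, (g x ^ 2 - 2 * r * (g x * Φ x))) + ∫ x, Φ x ^ 2 :=
      integral_add (hg2.sub (hgΦ.const_mul _)) hΦ2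
    have e2 : ∫ x, (g x ^ 2 - 2 * r * (g x * Φ x)) =
        (∫ x, g x ^ 2) - ∫ x, 2 * r * (g x * Φ x) := integral_sub hg2 (hgΦ.const_mul _)
    have e3 : ∫ x, 2 * r * (g x * Φ x) = 2 * r * I := by rw [integral_const_mul, hI]
    rw [e1, e2, e3]
  rw [eL, eR, hsplit s, hsplit c.re]
  have hre : c.re ≤ 1 := by
    have := Complex.abs_re_le_norm c
    rw [hc] at this
    exact (abs_le.1 this).2
  have hre' : -1 ≤ c.re := by
    have := Complex.abs_re_le_norm c
    rw [hc] at this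
    exact (abs_le.1 this).1
  have key : c.re * I ≤ s * I := by
    rw [hsI]
    rcases le_or_gt 0 I with h | h
    · rw [abs_of_nonneg h]; nlinarith
    · rw [abs_of_neg h]; nlinarith
  nlinarith [key]

/-- **Real minimising sequences converge up to SIGNS.** If `gₙ` are real-valued normalised window
test functions with `𝓔^w_a(gₙ) → coreBottom w a` and `Φ` is a real core ground state, then
`sₙ gₙ → Φ` in `L²` for suitable signs `sₙ = ±1`. [cite: Bombieri2000Weil, §4 Thm 3] -/
theorem tendsto_sign_mul_of_minimizing_real {a : ℝ} {w : ℕ → ℝ}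
    (hw : ∀ n ∈ weilPrimeIndex a, 0 ≤ w n) (ha : 0 < a) {Φ : ℝ → ℝ}
    (hΦ : IsCoreGround w a (fun x ↦ (Φ x : ℂ))) {g : ℕ → ℝ → ℝ}
    (hg : ∀ n, IsWeilTest (fun x ↦ (g n x : ℂ)) ∧ tsupport (fun x ↦ (g n x : ℂ)) ⊆ Icc (-a) a ∧
      ∫ t, ‖((g n t : ℝ) : ℂ)‖ ^ 2 = (1 : ℝ))
    (hE : Tendsto (fun n ↦ tableDirichletEnergy a w (fun x ↦ (g n x : ℂ))) atTop
      (𝓝 (coreBottom w a))) :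
    ∃ s : ℕ → ℝ, (∀ n, s n = 1 ∨ s n = -1) ∧
      Tendsto (fun n ↦ ∫ x, ‖((s n * g n x : ℝ) : ℂ) - (Φ x : ℂ)‖ ^ 2) atTop (𝓝 0) := by
  obtain ⟨c, hc, hlim⟩ := hΦ.tendsto_of_minimizing hw ha (g := fun n x ↦ (g n x : ℂ)) hg hE
  have hgL : ∀ n, MemLp (g n) 2 := fun n ↦ by
    have h := (hg n).1.memLp_two
    have : (g n) = fun x ↦ ((fun x ↦ (g n x : ℂ)) x).re := by funext x; simp
    rw [this]
    exact h.re
  have hΦL : MemLp Φ 2 := by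
    have h := hΦ.1.1
    have : Φ = fun x ↦ ((fun x ↦ (Φ x : ℂ)) x).re := by funext x; simp
    rw [this]
    exact h.re
  choose s hs hle using fun n ↦ exists_sign_integral_le (hgL n) hΦL (hc n)
  refine ⟨s, hs, squeeze_zero (fun n ↦ integral_nonneg fun _ ↦ by positivity) hle ?_⟩
  simpa using hlim

/-- **Asymptotic one-signedness of real minimising sequences** (the finite-approximation form of
channel (I)): with the signs of `tendsto_sign_mul_of_minimizing_real`, the NEGATIVE PARTS of
`sₙ gₙ` tend to zero in `L²`: `∫ (min (sₙ gₙ(x), 0))² dx → 0`. [cite: Bombieri2000Weil, §4 Thm 3] -/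
theorem tendsto_negPart_of_minimizing_real {a : ℝ} {w : ℕ → ℝ}
    (hw : ∀ n ∈ weilPrimeIndex a, 0 ≤ w n) (ha : 0 < a) {g : ℕ → ℝ → ℝ}
    (hg : ∀ n, IsWeilTest (fun x ↦ (g n x : ℂ)) ∧ tsupport (fun x ↦ (g n x : ℂ)) ⊆ Icc (-a) a ∧
      ∫ t, ‖((g n t : ℝ) : ℂ)‖ ^ 2 = (1 : ℝ))
    (hE : Tendsto (fun n ↦ tableDirichletEnergy a w (fun x ↦ (g n x : ℂ))) atTop
      (𝓝 (coreBottom w a))) :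
    ∃ s : ℕ → ℝ, (∀ n, s n = 1 ∨ s n = -1) ∧
      Tendsto (fun n ↦ ∫ x, (min (s n * g n x) 0) ^ 2) atTop (𝓝 0) := by
  -- the positive even ground representative, `Φ ≥ 0` a.e.
  obtain ⟨u, hu⟩ := exists_isCoreGround hw ha
  obtain ⟨Φ, γ, -, -, hΦp, hΦs, hΦg, -⟩ := hu.exists_pos_even_rep hw ha
  have hΦ0 : ∀ᵐ x : ℝ, 0 ≤ Φ x := by
    filter_upwards [compl_mem_ae_iff.2 (measure_singleton (-a) : volume {-a} = 0),
      compl_mem_ae_iff.2 (measure_singleton a : volume {a} = 0)] with x h1 h2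
    simp only [mem_compl_iff, mem_singleton_iff] at h1 h2
    by_cases hx : x ∈ Icc (-a) a
    · exact (hΦp x ⟨lt_of_le_of_ne (mem_Icc.1 hx).1 (Ne.symm h1),
        lt_of_le_of_ne (mem_Icc.1 hx).2 h2⟩).le
    · exact (hΦs x hx).symm.le
  obtain ⟨s, hs, hlim⟩ := tendsto_sign_mul_of_minimizing_real hw ha hΦg hg hE
  refine ⟨s, hs, squeeze_zero (fun n ↦ integral_nonneg fun _ ↦ by positivity) (fun n ↦ ?_) hlim⟩
  -- pointwise a.e.: `(min (s g, 0))² ≤ |s g − Φ|²` since `Φ ≥ 0`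
  have hΦL : MemLp (fun x ↦ (Φ x : ℂ)) 2 := hΦg.1.1
  have hD : MemLp (fun x ↦ ((s n * g n x : ℝ) : ℂ) - (Φ x : ℂ)) 2 := by
    have h1 : MemLp (fun x ↦ ((s n * g n x : ℝ) : ℂ)) 2 := by
      have := (hg n).1.memLp_two.const_mul ((s n : ℝ) : ℂ)
      refine this.ae_eq (Eventually.of_forall fun x ↦ ?_)
      push_cast; ring
    exact h1.sub hΦL
  have hint : Integrable (fun x ↦ ‖((s n * g n x : ℝ) : ℂ) - (Φ x : ℂ)‖ ^ 2) :=
    (memLp_two_iff_integrable_sq_norm hD.1).1 hD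
  refine integral_mono_of_nonneg (Eventually.of_forall fun x ↦ by positivity) hint ?_
  filter_upwards [hΦ0] with x hx
  rw [← Complex.ofReal_sub, Complex.norm_real, Real.norm_eq_abs, sq_abs]
  rcases le_or_gt 0 (s n * g n x) with h | h
  · rw [min_eq_right h, zero_pow two_ne_zero]; positivity
  · rw [min_eq_left h.le]; nlinarith

end Summit.RiemannHypothesis.RiemannHypothesis.Theorems.PfPersistence

end
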